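import Literature.Analysis.Complex.AnalyticCover
import Mathlib.Topology.Compactness.Lindelof
import HarnessLib

/-!
# Analytic curves in `ℂ²` as branched covers of a coordinate axis: sheets and slopes

Local structure of an analytic curve `Z ⊆ ℂ × ℂ` near a point `p = (z₀, w₀)` at which `Z` is
the zero set of a holomorphic `f` whose slice `f (z₀, ·)` does not vanish identically
(E. M. Chirka, *Complex Analytic Sets* (1989), §1.1–1.3; Griffiths–Harris, Ch. 0 §2, "analytic
varieties … locally a finite-sheeted branched cover"). By the Weierstrass preparation theorem
(`Literature/Analysis/Complex/WeierstrassPreparation.lean`) there is a **`z`-box**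
`ball z₀ ε × ball w₀ R` in which `Z = {(z, w) : w ∈ sliceRoots f w₀ r z}` — over each `z` a
finite fibre of at most `d` points (`PlaneCurve.ZBox`, `ZBox.mem_iff`, `ZBox.card_fibre_le`);
off the zero set of a holomorphic discriminant `μ ≢ 0` on the base disc the fibre points are the
values of finitely many holomorphic **sheets** with distinct values
(`Literature.Analysis.Complex.SCV.WeierstrassData.exists_discriminant_roots`), and every such
point is a **graph point** of `Z`: near it, `Z` is the graph of one holomorphic function
(`PlaneCurve.GraphData`, `ZBox.Sheets`, `ZBox.sheets`, `ZBox.isGraphPt_of_mem_good`). The derivative of that function is the intrinsic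
**slope** `PlaneCurve.slope Z p` of `Z` at `p` (independent of all choices,
`GraphData.slope_eq`, `slope_eq_deriv`); the non-graph points of `Z` in the box lie over the
countable zero set of `μ` (`ZBox.disc`, `ZBox.good`, `ZBox.countable_base_diff_good`,
`ZBox.countable_setOf_not_isGraphPt`).

These are the inputs of the sheet-sum current of an analytic curve
(`Literature/Analysis/Complex/PlaneCurveSheetSum.lean`), used for Zucker's theorem that a general
`J`-torus carries no analytic curve (`Literature/Barriers/HodgeConjecture/`).

## References

* E. M. Chirka, *Complex Analytic Sets*, Kluwer 1989, §1.1 (Weierstrass), §1.2 Prop. 1–2,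
  §1.3 (discriminant set), §2.3 (regular points). [Chirka1989]
* P. Griffiths, J. Harris, *Principles of Algebraic Geometry*, Wiley 1978, Ch. 0 §2.
  [GriffithsHarrisPrinciples1978]
-/

noncomputable section

open Set Filter Metric Topology Complex
open Literature.Analysis.Complex.SCV

namespace Literature.Analysis.Complex

namespace PlaneCurve

variable {Z : Set (ℂ × ℂ)} {p : ℂ × ℂ}

/-! ### Graph points and the intrinsic slope -/

/-- **Graph data** for `Z ⊆ ℂ × ℂ` at `p = (z₀, w₀)`: a polydisc `ball z₀ δ × ball w₀ ε` in which
`Z` is exactly the graph of a holomorphic function `α : ball z₀ δ → ball w₀ ε` with `α z₀ = w₀`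
(so `p` is a regular point of `Z` with non-vertical tangent line). [cite: Chirka1989, §2.3] -/
structure GraphData (Z : Set (ℂ × ℂ)) (p : ℂ × ℂ) where
  /-- radius of the base disc -/
  δ : ℝ
  /-- radius of the fibre disc -/
  ε : ℝ
  /-- the graph function -/
  α : ℂ → ℂ
  δ_pos : 0 < δ
  ε_pos : 0 < ε
  differentiableOn : DifferentiableOn ℂ α (ball p.1 δ)
  apply_fst : α p.1 = p.2
  mapsTo : MapsTo α (ball p.1 δ) (ball p.2 ε)
  inter_eq : Z ∩ ball p.1 δ ×ˢ ball p.2 ε = (fun z => (z, α z)) '' ball p.1 δ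

/-- `p` is a **graph point** of `Z`: near `p`, `Z` is the graph of a holomorphic function of the
first coordinate. [cite: Chirka1989, §2.3] -/
def IsGraphPt (Z : Set (ℂ × ℂ)) (p : ℂ × ℂ) : Prop :=
  Nonempty (GraphData Z p)

namespace GraphData

/-- Points of the graph lie on `Z`. [folklore] -/
theorem mk_mem (g : GraphData Z p) {z : ℂ} (hz : z ∈ ball p.1 g.δ) : (z, g.α z) ∈ Z := by
  have : (z, g.α z) ∈ Z ∩ ball p.1 g.δ ×ˢ ball p.2 g.ε := by
    rw [g.inter_eq]; exact ⟨z, hz, rfl⟩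
  exact this.1

/-- The base point lies on `Z`. [folklore] -/
theorem mem (g : GraphData Z p) : p ∈ Z := by
  have := g.mk_mem (mem_ball_self g.δ_pos)
  rwa [g.apply_fst] at this

/-- **Uniqueness in the box**: a point of `Z` in the polydisc lies on the graph. [folklore] -/
theorem eq_of_mem (g : GraphData Z p) {z w : ℂ} (hz : z ∈ ball p.1 g.δ) (hw : w ∈ ball p.2 g.ε)
    (h : (z, w) ∈ Z) : w = g.α z := by
  have : (z, w) ∈ Z ∩ ball p.1 g.δ ×ˢ ball p.2 g.ε := ⟨h, hz, hw⟩
  rw [g.inter_eq] at this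
  obtain ⟨z', -, hz'⟩ := this
  rw [Prod.mk.injEq] at hz'
  rw [← hz'.2, hz'.1]

/-- The graph function is continuous on the base disc. [folklore] -/
theorem continuousOn (g : GraphData Z p) : ContinuousOn g.α (ball p.1 g.δ) :=
  g.differentiableOn.continuousOn

/-- The graph function is analytic at the points of the base disc. [folklore] -/
theorem analyticAt (g : GraphData Z p) {z : ℂ} (hz : z ∈ ball p.1 g.δ) : AnalyticAt ℂ g.α z :=
  g.differentiableOn.analyticAt (isOpen_ball.mem_nhds hz)

/-- **Uniqueness of the local graph function**: any function `β`, continuous at `z₀` with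
`β z₀ = w₀` and whose graph lies in `Z` near `z₀`, agrees with `α` near `z₀`. [folklore] -/
theorem eventuallyEq (g : GraphData Z p) {β : ℂ → ℂ} (hβc : ContinuousAt β p.1)
    (hβ0 : β p.1 = p.2) (hβZ : ∀ᶠ z in 𝓝 p.1, (z, β z) ∈ Z) : β =ᶠ[𝓝 p.1] g.α := by
  have h1 : ∀ᶠ z in 𝓝 p.1, β z ∈ ball p.2 g.ε := by
    have : ball p.2 g.ε ∈ 𝓝 (β p.1) := by rw [hβ0]; exact ball_mem_nhds _ g.ε_pos
    exact hβc.preimage_mem_nhds this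
  have h2 : ∀ᶠ z in 𝓝 p.1, z ∈ ball p.1 g.δ := ball_mem_nhds _ g.δ_pos
  filter_upwards [h1, h2, hβZ] with z hz1 hz2 hz3
  exact g.eq_of_mem hz2 hz1 hz3

/-- **Graph points are stable**: the points of the graph near a graph point are graph points
(with, near them, the same graph function). [folklore] -/
theorem isGraphPt_shift (g : GraphData Z p) {z₁ : ℂ} (hz₁ : z₁ ∈ ball p.1 g.δ) :
    IsGraphPt Z (z₁, g.α z₁) := by
  -- a fibre disc around `α z₁` inside the old one, and a base disc mapped into it
  have hε₁ : 0 < g.ε - dist (g.α z₁) p.2 := sub_pos.2 (mem_ball.1 (g.mapsTo hz₁))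
  have hδ₁ : 0 < g.δ - dist z₁ p.1 := sub_pos.2 (mem_ball.1 hz₁)
  have hcont : ContinuousAt g.α z₁ :=
    (g.continuousOn z₁ hz₁).continuousAt (isOpen_ball.mem_nhds hz₁)
  have hpre : g.α ⁻¹' ball (g.α z₁) (g.ε - dist (g.α z₁) p.2) ∈ 𝓝 z₁ :=
    hcont.preimage_mem_nhds (ball_mem_nhds _ hε₁)
  obtain ⟨η, hη, hηsub⟩ := Metric.mem_nhds_iff.1 hpre
  have hsubδ : ball z₁ (min η (g.δ - dist z₁ p.1)) ⊆ ball p.1 g.δ := fun z hz => mem_ball.2 (by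
    have := mem_ball.1 (ball_subset_ball (min_le_right _ _) hz)
    linarith [dist_triangle z z₁ p.1])
  have hsubε : ball (g.α z₁) (g.ε - dist (g.α z₁) p.2) ⊆ ball p.2 g.ε := fun w hw => mem_ball.2 (by
    have := mem_ball.1 hw
    linarith [dist_triangle w (g.α z₁) p.2])
  refine ⟨{ δ := min η (g.δ - dist z₁ p.1)
            ε := g.ε - dist (g.α z₁) p.2
            α := g.α
            δ_pos := lt_min hη hδ₁
            ε_pos := hε₁
            differentiableOn := g.differentiableOn.mono hsubδ
            apply_fst := rfl
            mapsTo := fun z hz => hηsub (ball_subset_ball (min_le_left _ _) hz)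
            inter_eq := ?_ }⟩
  ext ⟨z, w⟩
  simp only [mem_inter_iff, mem_prod, mem_image, Prod.mk.injEq]
  constructor
  · rintro ⟨hZ, hz, hw⟩
    exact ⟨z, hz, rfl, (g.eq_of_mem (hsubδ hz) (hsubε hw) hZ).symm⟩
  · rintro ⟨z', hz', rfl, rfl⟩
    exact ⟨g.mk_mem (hsubδ hz'), hz', hηsub (ball_subset_ball (min_le_left _ _) hz')⟩

end GraphData

open Classical in
/-- The **slope** of `Z` at `p`: the derivative at `p.1` of the function of which `Z` is locally
the graph, if `p` is a graph point (well defined by `GraphData.eventuallyEq`), and `0` otherwise.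
The tangent line of `Z` at a graph point `p` is `ℂ · (1, slope Z p)`. [cite: Chirka1989, §2.3] -/
def slope (Z : Set (ℂ × ℂ)) (p : ℂ × ℂ) : ℂ :=
  if h : IsGraphPt Z p then deriv (Classical.choice h).α p.1 else 0

/-- **The slope is intrinsic**: it is the derivative of ANY graph datum. [folklore] -/
theorem GraphData.slope_eq (g : GraphData Z p) : slope Z p = deriv g.α p.1 := by
  have h : IsGraphPt Z p := ⟨g⟩
  rw [slope, dif_pos h]
  set g' := Classical.choice h
  have hev : g'.α =ᶠ[𝓝 p.1] g.α :=
    g.eventuallyEq ((g'.continuousOn p.1 (mem_ball_self g'.δ_pos)).continuousAt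
      (ball_mem_nhds _ g'.δ_pos)) g'.apply_fst
      (Filter.eventually_of_mem (ball_mem_nhds _ g'.δ_pos) fun z hz => g'.mk_mem hz)
  exact hev.deriv_eq

/-- The slope at a graph point is the derivative of any function `β`, continuous at `p.1` with
`β p.1 = p.2`, whose graph lies in `Z` near `p.1`. [folklore] -/
theorem slope_eq_deriv (h : IsGraphPt Z p) {β : ℂ → ℂ} (hβc : ContinuousAt β p.1)
    (hβ0 : β p.1 = p.2) (hβZ : ∀ᶠ z in 𝓝 p.1, (z, β z) ∈ Z) : slope Z p = deriv β p.1 := by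
  obtain ⟨g⟩ := h
  rw [g.slope_eq]
  exact ((g.eventuallyEq hβc hβ0 hβZ).deriv_eq).symm

/-- Along a graph, the slope is the derivative of the graph function. [folklore] -/
theorem GraphData.slope_shift (g : GraphData Z p) {z₁ : ℂ} (hz₁ : z₁ ∈ ball p.1 g.δ) :
    slope Z (z₁, g.α z₁) = deriv g.α z₁ :=
  slope_eq_deriv (g.isGraphPt_shift hz₁)
    ((g.continuousOn z₁ hz₁).continuousAt (isOpen_ball.mem_nhds hz₁)) rfl
    (Filter.eventually_of_mem (isOpen_ball.mem_nhds hz₁) fun _ hz => g.mk_mem hz)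

/-! ### Translation covariance -/

/-- Distances after translation. [folklore] -/
theorem mem_ball_sub_iff {z c u : ℂ} {r : ℝ} : z - u ∈ ball c r ↔ z ∈ ball (c + u) r := by
  rw [mem_ball, mem_ball, dist_eq_norm, dist_eq_norm, sub_sub, add_comm u c]

/-- **Graph data translate**: translating `Z` by `v` translates graph data at `p` to graph data
at `p + v`, with graph function `z ↦ α (z - v.1) + v.2`. [folklore] -/
def GraphData.translate (g : GraphData Z p) (v : ℂ × ℂ) :
    GraphData ((· + v) '' Z) (p + v) where
  δ := g.δ
  ε := g.ε
  α z := g.α (z - v.1) + v.2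
  δ_pos := g.δ_pos
  ε_pos := g.ε_pos
  differentiableOn := by
    refine DifferentiableOn.add_const (v.2) (g.differentiableOn.comp (by fun_prop) fun z hz => ?_)
    exact mem_ball_sub_iff.2 (by simpa only [Prod.fst_add] using hz)
  apply_fst := by simp [g.apply_fst]
  mapsTo z hz := by
    have hz' : z - v.1 ∈ ball p.1 g.δ := mem_ball_sub_iff.2 (by simpa only [Prod.fst_add] using hz)
    have h := mem_ball_sub_iff.1 (show g.α (z - v.1) + v.2 - v.2 ∈ ball p.2 g.ε by
      rw [add_sub_cancel_right]; exact g.mapsTo hz')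
    simpa only [Prod.snd_add] using h
  inter_eq := by
    ext q
    constructor
    · rintro ⟨⟨q₀, hq₀Z, rfl⟩, hz, hw⟩
      change q₀.1 + v.1 ∈ ball (p.1 + v.1) g.δ at hz
      change q₀.2 + v.2 ∈ ball (p.2 + v.2) g.ε at hw
      have hz' : q₀.1 ∈ ball p.1 g.δ := by
        rw [← add_sub_cancel_right q₀.1 v.1]; exact mem_ball_sub_iff.2 hz
      have hw' : q₀.2 ∈ ball p.2 g.ε := by
        rw [← add_sub_cancel_right q₀.2 v.2]; exact mem_ball_sub_iff.2 hw
      refine ⟨q₀.1 + v.1, hz, ?_⟩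
      change (q₀.1 + v.1, g.α (q₀.1 + v.1 - v.1) + v.2) = q₀ + v
      rw [add_sub_cancel_right, ← g.eq_of_mem hz' hw' hq₀Z]
      rfl
    · rintro ⟨z', hz', rfl⟩
      have hz'' : z' - v.1 ∈ ball p.1 g.δ := mem_ball_sub_iff.2 hz'
      refine ⟨⟨(z' - v.1, g.α (z' - v.1)), g.mk_mem hz'', ?_⟩, hz', ?_⟩
      · change (z' - v.1 + v.1, g.α (z' - v.1) + v.2) = (z', g.α (z' - v.1) + v.2)
        rw [sub_add_cancel]
      · exact mem_ball_sub_iff.1 (by rw [add_sub_cancel_right]; exact g.mapsTo hz'')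

/-- Graph points are translation covariant. [folklore] -/
theorem IsGraphPt.translate (h : IsGraphPt Z p) (v : ℂ × ℂ) : IsGraphPt ((· + v) '' Z) (p + v) :=
  ⟨(Classical.choice h).translate v⟩

/-- Translating back. [folklore] -/
theorem image_add_image_add_neg (Z : Set (ℂ × ℂ)) (v : ℂ × ℂ) :
    (· + -v) '' ((· + v) '' Z) = Z := by
  rw [Set.image_image]; simp

/-- Graph points are translation invariant (iff form). [folklore] -/
theorem isGraphPt_translate_iff (v : ℂ × ℂ) : IsGraphPt ((· + v) '' Z) (p + v) ↔ IsGraphPt Z p := by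
  refine ⟨fun h => ?_, fun h => h.translate v⟩
  have := h.translate (-v)
  rwa [image_add_image_add_neg, add_neg_cancel_right] at this

/-- **The slope is translation covariant.** [folklore] -/
theorem slope_translate (Z : Set (ℂ × ℂ)) (p v : ℂ × ℂ) :
    slope ((· + v) '' Z) (p + v) = slope Z p := by
  by_cases h : IsGraphPt Z p
  · obtain ⟨g⟩ := h
    rw [(g.translate v).slope_eq, g.slope_eq]
    change deriv (fun z => g.α (z - v.1) + v.2) (p.1 + v.1) = deriv g.α p.1
    rw [deriv_add_const, deriv_comp_sub_const, add_sub_cancel_right]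
  · have h' : ¬ IsGraphPt ((· + v) '' Z) (p + v) := fun h' => h ((isGraphPt_translate_iff v).1 h')
    rw [slope, dif_neg h', slope, dif_neg h]

/-! ### `z`-boxes: the Weierstrass description of `Z` over a disc -/

/-- A **`z`-box** of `Z`: Weierstrass data `f` on `ball z₀ ε × ball c R` (holomorphic, zero-free
on the circles `{z} × {|w - c| = r}`) whose zero set is `Z` inside the box; then over every
`z ∈ ball z₀ ε` the points of `Z` in `{z} × ball c r` are the zeros `sliceRoots f c r z` of the
slice, at most `d = card (sliceRoots f c r z₀)` of them. [cite: Chirka1989, §1.1] -/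
structure ZBox (Z : Set (ℂ × ℂ)) where
  /-- the defining function -/
  f : ℂ × ℂ → ℂ
  /-- centre of the base disc -/
  z₀ : ℂ
  /-- radius of the base disc -/
  ε : ℝ
  /-- centre of the fibre discs -/
  c : ℂ
  /-- inner fibre radius -/
  r : ℝ
  /-- outer fibre radius -/
  R : ℝ
  ε_pos : 0 < ε
  data : WeierstrassData f (ball z₀ ε) c r R
  inter_eq : Z ∩ ball z₀ ε ×ˢ ball c R = ball z₀ ε ×ˢ ball c R ∩ f ⁻¹' {0}

namespace ZBox

variable (B : ZBox Z)

/-- The base disc. [folklore] -/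
abbrev base : Set ℂ := ball B.z₀ B.ε

/-- The open box `ball z₀ ε × ball c r` (inner fibre radius). [folklore] -/
abbrev box : Set (ℂ × ℂ) := B.base ×ˢ ball B.c B.r

/-- The base disc is preconnected. [folklore] -/
theorem isPreconnected_base : IsPreconnected B.base := (convex_ball _ _).isPreconnected

/-- The centre lies in the base disc. [folklore] -/
theorem z₀_mem : B.z₀ ∈ B.base := mem_ball_self B.ε_pos

/-- **Membership**: over `z` in the base disc, a point `(z, w)` with `w` in the inner fibre disc
lies on `Z` iff `w` is a root of the slice `f (z, ·)`. [cite: Chirka1989, §1.1] -/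
theorem mem_iff {z w : ℂ} (hz : z ∈ B.base) (hw : w ∈ ball B.c B.r) :
    (z, w) ∈ Z ↔ w ∈ sliceRoots B.f B.c B.r z := by
  rw [sliceRoots, mem_rootMultiset_iff (B.data.differentiableOn_slice hz) B.data.pos B.data.lt
    (B.data.ne_zero z hz)]
  have hwR : w ∈ ball B.c B.R := ball_subset_ball B.data.lt.le hw
  constructor
  · intro h
    have : (z, w) ∈ Z ∩ ball B.z₀ B.ε ×ˢ ball B.c B.R := ⟨h, hz, hwR⟩
    rw [B.inter_eq] at this
    exact ⟨hw, this.2⟩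
  · rintro ⟨-, h0⟩
    have : (z, w) ∈ ball B.z₀ B.ε ×ˢ ball B.c B.R ∩ B.f ⁻¹' {0} := ⟨⟨hz, hwR⟩, h0⟩
    rw [← B.inter_eq] at this
    exact this.1

/-- Roots of the slices lie in the inner fibre disc. [folklore] -/
theorem mem_ball_of_mem_sliceRoots {z w : ℂ} (hw : w ∈ sliceRoots B.f B.c B.r z) :
    w ∈ ball B.c B.r :=
  mem_ball_of_mem_rootMultiset hw

/-- Roots of the slices are points of `Z`. [folklore] -/
theorem mk_mem_of_mem_sliceRoots {z w : ℂ} (hz : z ∈ B.base) (hw : w ∈ sliceRoots B.f B.c B.r z) :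
    (z, w) ∈ Z :=
  (B.mem_iff hz (B.mem_ball_of_mem_sliceRoots hw)).2 hw

/-- The **degree** of the box: the number of roots (with multiplicity) of any slice.
[cite: Chirka1989, §1.1] -/
def deg : ℕ := (sliceRoots B.f B.c B.r B.z₀).card

/-- The number of roots with multiplicity is constant over the base disc. [cite: Chirka1989, §1.1] -/
theorem card_sliceRoots {z : ℂ} (hz : z ∈ B.base) : (sliceRoots B.f B.c B.r z).card = B.deg :=
  B.data.card_sliceRoots_eq B.isPreconnected_base B.z₀_mem hz

/-- The **fibre** of the box over `z`: the finite set of `w ∈ ball c r` with `(z, w) ∈ Z`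
(the distinct roots of the slice). [cite: Chirka1989, §1.1] -/
def fibre (z : ℂ) : Finset ℂ := (sliceRoots B.f B.c B.r z).toFinset

/-- Membership in the fibre. [folklore] -/
theorem mem_fibre_iff {z w : ℂ} (hz : z ∈ B.base) :
    w ∈ B.fibre z ↔ w ∈ ball B.c B.r ∧ (z, w) ∈ Z := by
  rw [fibre, Multiset.mem_toFinset]
  exact ⟨fun h => ⟨B.mem_ball_of_mem_sliceRoots h, B.mk_mem_of_mem_sliceRoots hz h⟩,
    fun h => (B.mem_iff hz h.1).1 h.2⟩

/-- **At most `deg` points in each fibre.** [cite: Chirka1989, §1.1] -/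
theorem card_fibre_le {z : ℂ} (hz : z ∈ B.base) : (B.fibre z).card ≤ B.deg := by
  rw [fibre, ← B.card_sliceRoots hz]
  exact Multiset.toFinset_card_le _

/-- The points of `Z` in the box, over `z`, form the fibre. [folklore] -/
theorem setOf_mem_eq_fibre {z : ℂ} (hz : z ∈ B.base) :
    {w | w ∈ ball B.c B.r ∧ (z, w) ∈ Z} = ↑(B.fibre z) := by
  ext w
  rw [Finset.mem_coe, B.mem_fibre_iff hz]
  rfl

end ZBox

/-! ### Existence of `z`-boxes -/

/-- `Z` **is Weierstrass at `p`** (with respect to the second coordinate): near `p`, `Z` is the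
zero set of a holomorphic function whose slice `w ↦ f (p.1, w)` does not vanish identically
near `p.2`. Every analytic hypersurface germ not containing the vertical line germ through `p`
is of this kind. [cite: Chirka1989, §1.1] -/
def IsWeierstrassAt (Z : Set (ℂ × ℂ)) (p : ℂ × ℂ) : Prop :=
  ∃ U : Set (ℂ × ℂ), IsOpen U ∧ p ∈ U ∧ ∃ f : ℂ × ℂ → ℂ, DifferentiableOn ℂ f U ∧
    Z ∩ U = U ∩ f ⁻¹' {0} ∧ ¬ ((fun w => f (p.1, w)) =ᶠ[𝓝 p.2] 0)

/-- **Existence of `z`-boxes** (Weierstrass preparation, `exists_weierstrassData`): if `Z` is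
Weierstrass at `p`, then inside any neighbourhood `V` of `p` there is a `z`-box of `Z` centred at
`p` (`z₀ = p.1`, `c = p.2`). [cite: Chirka1989, §1.1, p. 3] -/
theorem IsWeierstrassAt.exists_zbox (h : IsWeierstrassAt Z p) {V : Set (ℂ × ℂ)} (hV : V ∈ 𝓝 p) :
    ∃ B : ZBox Z, B.z₀ = p.1 ∧ B.c = p.2 ∧ ball B.z₀ B.ε ×ˢ ball B.c B.R ⊆ V := by
  obtain ⟨U, hUo, hpU, f, hf, hZU, hne⟩ := h
  obtain ⟨V', hV'V, hV'o, hpV'⟩ := _root_.mem_nhds_iff.1 hV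
  set Ω := U ∩ V' with hΩ
  have hΩo : IsOpen Ω := hUo.inter hV'o
  have hpΩ : ((p.1, p.2) : ℂ × ℂ) ∈ Ω := ⟨hpU, hpV'⟩
  obtain ⟨ε, r, R, hε, hsub, hW, -, -⟩ := exists_weierstrassData hΩo (hf.mono inter_subset_left) hpΩ hne
  refine ⟨⟨f, p.1, ε, p.2, r, R, hε, hW, ?_⟩, rfl, rfl, hsub.trans (inter_subset_right.trans hV'V)⟩
  have hsubU : ball p.1 ε ×ˢ ball p.2 R ⊆ U := hsub.trans inter_subset_left
  apply Subset.antisymm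
  · rintro q ⟨hqZ, hq⟩
    have : q ∈ Z ∩ U := ⟨hqZ, hsubU hq⟩
    rw [hZU] at this
    exact ⟨hq, this.2⟩
  · rintro q ⟨hq, hq0⟩
    have : q ∈ U ∩ f ⁻¹' {0} := ⟨hsubU hq, hq0⟩
    rw [← hZU] at this
    exact ⟨this.1, hq⟩

/-! ### Sheets off the discriminant; graph points -/

namespace ZBox

variable (B : ZBox Z)

/-- **Local sheets.** Around a point `z₁` of the base disc where the number of distinct roots is
locally maximal (i.e. off the discriminant), the fibres of the box are the values of finitely
many holomorphic functions with pairwise distinct values, and every fibre point is a graph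
point of `Z` whose slope is the derivative of its sheet. Data-carrying version of
`WeierstrassData.exists_discriminant_roots`. [cite: Chirka1989, §1.2 Prop. 2, §1.3] -/
structure Sheets (B : ZBox Z) (z₁ : ℂ) where
  /-- radius of the disc carrying the sheets -/
  δ : ℝ
  /-- number of sheets -/
  s : ℕ
  /-- the sheets -/
  β : Fin s → ℂ → ℂ
  δ_pos : 0 < δ
  ball_subset : ball z₁ δ ⊆ B.base
  differentiableOn : ∀ i, DifferentiableOn ℂ (β i) (ball z₁ δ)
  injective : ∀ z ∈ ball z₁ δ, ∀ i j, i ≠ j → β i z ≠ β j z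
  β_mem : ∀ z ∈ ball z₁ δ, ∀ i, β i z ∈ ball B.c B.r
  roots_iff : ∀ z ∈ ball z₁ δ, ∀ w, w ∈ sliceRoots B.f B.c B.r z ↔ ∃ i, w = β i z

namespace Sheets

variable {B} {z₁ : ℂ} (S : B.Sheets z₁)

/-- The fibre over a point of the sheet disc is the set of sheet values. [folklore] -/
theorem fibre_eq {z : ℂ} (hz : z ∈ ball z₁ S.δ) :
    B.fibre z = Finset.univ.image fun i => S.β i z := by
  ext w
  rw [ZBox.fibre, Multiset.mem_toFinset, S.roots_iff z hz, Finset.mem_image]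
  simp only [Finset.mem_univ, true_and, eq_comm]

/-- The sheet values are fibre points, hence points of `Z`. [folklore] -/
theorem mk_mem {z : ℂ} (hz : z ∈ ball z₁ S.δ) (i : Fin S.s) : (z, S.β i z) ∈ Z :=
  B.mk_mem_of_mem_sliceRoots (S.ball_subset hz) ((S.roots_iff z hz _).2 ⟨i, rfl⟩)

/-- Sums over the fibre are sums over the sheets. [folklore] -/
theorem sum_fibre_eq {M : Type*} [AddCommMonoid M] {z : ℂ} (hz : z ∈ ball z₁ S.δ) (φ : ℂ → M) :
    ∑ w ∈ B.fibre z, φ w = ∑ i, φ (S.β i z) := by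
  rw [S.fibre_eq hz, Finset.sum_image]
  intro i _ j _ h
  by_contra hij
  exact S.injective z hz i j hij h

/-- **Fibre points off the discriminant are graph points**: `Z` near `(z, β i z)` is the graph
of the sheet `β i` (the other sheets stay away by continuity). [cite: Chirka1989, §1.3, §2.3] -/
theorem isGraphPt {z : ℂ} (hz : z ∈ ball z₁ S.δ) (i : Fin S.s) : IsGraphPt Z (z, S.β i z) := by
  classical
  -- separation radius `η`: at most the room left in the fibre disc and half of every gap
  have hroom : 0 < B.r - dist (S.β i z) B.c := sub_pos.2 (mem_ball.1 (S.β_mem z hz i))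
  obtain ⟨η, hη_pos, hη_le_room, hη_le_gap⟩ : ∃ η : ℝ, 0 < η ∧ η ≤ B.r - dist (S.β i z) B.c ∧
      ∀ j, j ≠ i → 2 * η ≤ dist (S.β j z) (S.β i z) := by
    set gaps : Finset ℝ := (Finset.univ.filter fun j => j ≠ i).image
      fun j => dist (S.β j z) (S.β i z) / 2 with hgaps
    refine ⟨(insert (B.r - dist (S.β i z) B.c) gaps).min' (Finset.insert_nonempty _ _), ?_, ?_, ?_⟩
    · rw [Finset.lt_min'_iff]
      intro x hx
      rcases Finset.mem_insert.1 hx with rfl | hx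
      · exact hroom
      · obtain ⟨j, hj, rfl⟩ := Finset.mem_image.1 hx
        exact half_pos (dist_pos.2 (S.injective z hz j i (Finset.mem_filter.1 hj).2))
    · exact Finset.min'_le _ _ (Finset.mem_insert_self _ _)
    · intro j hji
      have hmem : dist (S.β j z) (S.β i z) / 2 ∈ insert (B.r - dist (S.β i z) B.c) gaps :=
        Finset.mem_insert_of_mem (Finset.mem_image.2
          ⟨j, Finset.mem_filter.2 ⟨Finset.mem_univ _, hji⟩, rfl⟩)
      have := Finset.min'_le _ _ hmem
      linarith
  -- a base radius `ρ` on which every sheet moves by less than `η`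
  have hcont : ∀ j, ContinuousAt (S.β j) z := fun j =>
    ((S.differentiableOn j).continuousOn z hz).continuousAt (isOpen_ball.mem_nhds hz)
  have hev : ∀ᶠ y in 𝓝 z, y ∈ ball z₁ S.δ ∧ ∀ j, dist (S.β j y) (S.β j z) < η := by
    refine Filter.Eventually.and (isOpen_ball.mem_nhds hz) ?_
    exact eventually_all.2 fun j => Metric.tendsto_nhds.1 (hcont j) η hη_pos
  obtain ⟨ρ, hρ, hρev⟩ := Metric.eventually_nhds_iff.1 hev
  have hρδ : ball z ρ ⊆ ball z₁ S.δ := fun y hy => (hρev hy).1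
  refine ⟨{ δ := ρ
            ε := η
            α := S.β i
            δ_pos := hρ
            ε_pos := hη_pos
            differentiableOn := (S.differentiableOn i).mono hρδ
            apply_fst := rfl
            mapsTo := fun y hy => (hρev (mem_ball.1 hy)).2 i
            inter_eq := ?_ }⟩
  ext ⟨y, w⟩
  simp only [mem_inter_iff, mem_prod, mem_image, Prod.mk.injEq]
  constructor
  · rintro ⟨hZ, hy, hw⟩
    refine ⟨y, hy, rfl, ?_⟩
    have hyδ : y ∈ ball z₁ S.δ := hρδ hy
    have hwr : w ∈ ball B.c B.r := mem_ball.2 (by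
      have := mem_ball.1 hw
      linarith [dist_triangle w (S.β i z) B.c])
    obtain ⟨j, rfl⟩ := (S.roots_iff y hyδ w).1 ((B.mem_iff (S.ball_subset hyδ) hwr).1 hZ)
    by_contra hji
    have hji' : j ≠ i := fun h => hji (by rw [h])
    have h1 : dist (S.β j y) (S.β j z) < η := (hρev (mem_ball.1 hy)).2 j
    have h2 : dist (S.β j y) (S.β i z) < η := mem_ball.1 hw
    have h3 := hη_le_gap j hji'
    linarith [dist_triangle_left (S.β j z) (S.β i z) (S.β j y)]
  · rintro ⟨y', hy', rfl, rfl⟩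
    exact ⟨S.mk_mem (hρδ hy') i, hy', (hρev (mem_ball.1 hy')).2 i⟩

/-- **The slope along a sheet is the derivative of the sheet.** [cite: Chirka1989, §2.3] -/
theorem slope_eq {z : ℂ} (hz : z ∈ ball z₁ S.δ) (i : Fin S.s) :
    slope Z (z, S.β i z) = deriv (S.β i) z :=
  slope_eq_deriv (S.isGraphPt hz i)
    (((S.differentiableOn i).continuousOn z hz).continuousAt (isOpen_ball.mem_nhds hz)) rfl
    (Filter.eventually_of_mem (isOpen_ball.mem_nhds hz) fun _ hy => S.mk_mem hy i)

end Sheets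


/-! ### The discriminant of a box -/

/-- Existence of the discriminant: a holomorphic `μ ≢ 0` on the base disc off whose zeros the
box has local sheets (`WeierstrassData.exists_discriminant_roots`). [cite: Chirka1989, §1.3] -/
theorem exists_disc : ∃ μ : ℂ → ℂ, DifferentiableOn ℂ μ B.base ∧ (∃ z ∈ B.base, μ z ≠ 0) ∧
    ∀ z₁ ∈ B.base, μ z₁ ≠ 0 → Nonempty (B.Sheets z₁) := by
  obtain ⟨μ, hμd, hμne, hμ⟩ :=
    B.data.exists_discriminant_roots B.isPreconnected_base ⟨B.z₀, B.z₀_mem⟩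
  refine ⟨μ, hμd, hμne, fun z₁ hz₁ hμz₁ => ?_⟩
  obtain ⟨δ, hδ, hδsub, s, β, hβd, hβinj, hβmem, hβiff⟩ := hμ z₁ hz₁ hμz₁
  exact ⟨⟨δ, s, β, hδ, hδsub, hβd, hβinj, hβmem, hβiff⟩⟩

/-- **The discriminant** `μ` of the box (a choice). [cite: Chirka1989, §1.3] -/
def disc : ℂ → ℂ := B.exists_disc.choose

/-- The discriminant is holomorphic on the base disc. [cite: Chirka1989, §1.3] -/
theorem differentiableOn_disc : DifferentiableOn ℂ B.disc B.base := B.exists_disc.choose_spec.1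

/-- The discriminant does not vanish identically. [cite: Chirka1989, §1.3] -/
theorem exists_disc_ne_zero : ∃ z ∈ B.base, B.disc z ≠ 0 := B.exists_disc.choose_spec.2.1

/-- The **good set** of the box: the points of the base disc where the discriminant does not
vanish. [cite: Chirka1989, §1.3] -/
def good : Set ℂ := {z | z ∈ B.base ∧ B.disc z ≠ 0}

/-- The good set lies in the base disc. [folklore] -/
theorem good_subset : B.good ⊆ B.base := fun _ hz => hz.1

/-- The good set is open. [folklore] -/
theorem isOpen_good : IsOpen B.good :=
  B.differentiableOn_disc.continuousOn.isOpen_inter_preimage isOpen_ball isOpen_compl_singleton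

/-- **Local sheets at a good point** (a choice). [cite: Chirka1989, §1.3] -/
def sheets {z₁ : ℂ} (hz₁ : z₁ ∈ B.good) : B.Sheets z₁ :=
  Classical.choice (B.exists_disc.choose_spec.2.2 z₁ hz₁.1 hz₁.2)

/-- **The bad set is countable**: the zeros of the discriminant in the base disc form a countable
(indeed discrete) set, by the identity theorem. [cite: Chirka1989, §1.3] -/
theorem countable_base_diff_good : (B.base \ B.good).Countable := by
  have han : AnalyticOnNhd ℂ B.disc B.base := B.differentiableOn_disc.analyticOnNhd isOpen_ball
  have heq : B.base \ B.good = {z | B.disc z = 0} ∩ B.base := by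
    ext z
    simp only [good, Set.mem_sdiff, mem_setOf_eq, mem_inter_iff, not_and, not_not]
    tauto
  rw [heq]
  rcases han.eqOn_zero_or_eventually_ne_zero_of_preconnected B.isPreconnected_base with h | h
  · obtain ⟨z, hz, hne⟩ := B.exists_disc_ne_zero
    exact absurd (h hz) hne
  · apply (HereditarilyLindelofSpace.isLindelof _).countable_of_isDiscrete
      (isDiscrete_of_codiscreteWithin _)
    rw [compl_setOf]
    exact h

/-- The bad set has measure zero. [folklore] -/
theorem volume_base_diff_good : MeasureTheory.volume (B.base \ B.good) = 0 :=
  B.countable_base_diff_good.measure_zero _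

/-- **Fibre points over good points are graph points.** [cite: Chirka1989, §1.3, §2.3] -/
theorem isGraphPt_of_mem_good {z w : ℂ} (hz : z ∈ B.good) (hw : w ∈ B.fibre z) :
    IsGraphPt Z (z, w) := by
  set S := B.sheets hz
  have hzδ : z ∈ ball z S.δ := mem_ball_self S.δ_pos
  rw [S.fibre_eq hzδ, Finset.mem_image] at hw
  obtain ⟨i, -, rfl⟩ := hw
  exact S.isGraphPt hzδ i

/-- **The non-graph points of `Z` in the box are countable**: they lie in the finite fibres over
the countable bad set. [cite: Chirka1989, §1.3, §2.3] -/
theorem countable_setOf_not_isGraphPt :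
    {q : ℂ × ℂ | q ∈ Z ∧ q ∈ B.box ∧ ¬ IsGraphPt Z q}.Countable := by
  have hsub : {q : ℂ × ℂ | q ∈ Z ∧ q ∈ B.box ∧ ¬ IsGraphPt Z q} ⊆
      ⋃ z ∈ B.base \ B.good, (fun w => (z, w)) '' ↑(B.fibre z) := by
    rintro ⟨z, w⟩ ⟨hZ, ⟨hz, hw⟩, hng⟩
    have hwf : w ∈ B.fibre z := (B.mem_fibre_iff hz).2 ⟨hw, hZ⟩
    have hzg : z ∉ B.good := fun hzg => hng (B.isGraphPt_of_mem_good hzg hwf)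
    exact mem_biUnion (x := z) ⟨hz, hzg⟩ ⟨w, hwf, rfl⟩
  exact (B.countable_base_diff_good.biUnion fun z _ =>
    (B.fibre z).finite_toSet.countable.image _).mono hsub

end ZBox

end PlaneCurve

end Literature.Analysis.Complex
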